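import Summits.QuantumFields.YangMills.Theorems.UnitScaleTiltProp8FlatProp4Bg1Weighted
import Summits.QuantumFields.YangMills.Theorems.UnitScaleTiltProp8FlatCubeSequenceLevelGap
import HarnessLib

/-!
# Route `UnitScaleTilt`, crux K1 child «MinimiserStabilityRegPr» (stmt-QuantumFields-19200), registered stub V2′ `stub_halvingStep` (v8 5b4e846794b80374 ∕ v10
# `BirthV10`) — pillar P3b AT THE CUBE SEQUENCE: **[Balaban1985Variational] PROPOSITION 4 (98) FOR THE PURE-ACTION GRADIENT `W₀ = (δ/δA)V₀` IN THE LEVEL-WEIGHTED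
# (152)-SIZES OF THE ALIGNED CUBE SEQUENCE (144) CENTRED AT `x₀`** — the `hWq` hypothesis of the cube-sequence socket
# `FlatSmallSolution158CubeSeq.existsUnique_smallSolution158_dom` ∕ `letter_solution158_dom_le` (and of this seat's `HalvingA1Row165.row165_of_smallSolution(_layer)`)
# for the pure-action part of `W`, by name: `FlatProp4Bg1.exists_gradient_prop4_bg1_T3` ((grad), entire) + `weighted98_dom_T3` (the weighted bound from the local
# two-parameter estimate) + `FlatCubeSequenceAligned.levWeight_le_mul_of_dist_le_two` (the level weights are `L`-comparable within distance `2` when `S ≥ 2L`)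

Cell `ym3-torus` (HUMAN RULING D-0037, YM ladder rung R3 — continuum SU(2) YM₃ on the torus is a RUNG, not the Clay problem), width seat `ym-ust-19200-w5` gen 2
(P3b lineage, closing line).  `--supports stmt-QuantumFields-19200 --as helper`; def-free, 0 sorry, standard axioms.

THE PRINT (T. Bałaban, CMP **102** (1985) 277–309; journal page = PDF page + 276).  p. 293 (98): *«|(δ/δA′)V(A′)|₍₋₃₎ ≤ C₄(max{|A′|₍₋₁₎, |∇A′|₍₋₂₎})² … valid if
max{…} ≤ a₃ … The constants a₃, C₄ depend on d and L only»*; (152) p. 301; (158) p. 302: *«A₁ + G̃((δ/δA′)V)(A₁ + HB) = 0»*.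

WHAT THIS FILE PROVES: **`exists_gradient_weighted98_cubeSeq_T3`** — for every member `F`, heights `n, K`, centre `x₀`, cube-sequence parameters `ρ, S, M` (`1 ≤ M`,
`2L ≤ S`) and the level weights `w` of `cubeSeqMT3 F n K x₀ ρ S M` (`IsLevWeight`): P3b's `W₀` (the (grad) identity for `𝒱_η`, `η = L^{−(K−n)}`; entire; the one-level
letter of `exists_gradient_prop4_bg1_T3`) satisfies ALSO the level-weighted (98): `w 3 b·‖W₀(Y)(b)‖ ≤ 12L³(1428 + L)·r²` whenever `w 1 b·‖Y(b)‖ ≤ r` and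
`w 2 b·L^{K−n}·‖Y(b + e_ν) − Y(b)‖ ≤ r` everywhere and `r < 1/(2L)` — `a₃ = 1/(2L)`, `C₄ = 12L³(1428 + L)` depend on `L` only, as print says.
HONEST SCOPE: pure action `V₀`; the dressing (85)–(89) is `FlatProp4Dressing` (displayed letters); NOT a claim about the stub, the crux, the rung or the gap.

References: T. Bałaban, CMP **102** (1985) 277–309 [Balaban1985Variational] (97)–(98) pp.292–293, (144) p.300, (152) p.301, (158) p.302.
-/

set_option autoImplicit false

noncomputable section

open scoped BigOperators Matrix.Norms.L2Operator
open NormedSpace Finset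

namespace Summit.QuantumFields.YangMills.Theorems.FlatProp4Bg1

open Literature.MathematicalPhysics.QuantumFieldTheory.Balaban1983to89
open T3ContinuumYM3Torus (T3Family)
open FlatCubeOpsText (IsLevWeight)
open FlatCubeSequenceAligned (cubeSeqMT3 levWeight_le_mul_of_dist_le_two)

/-- **P3b AT THE CUBE SEQUENCE, LEVEL-WEIGHTED (98) INCLUDED** (see the module docstring). [cite: Balaban1985Variational, Prop. 4 (97)-(98) pp.292-293, (152) p.301, (158) p.302] -/
theorem exists_gradient_weighted98_cubeSeq_T3 (F : T3Family) (n K : ℕ) (x₀ : Site (F.P K) 0) (ρ S M : ℕ) (hM : 1 ≤ M) (hS : 2 * F.L ≤ S)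
    {w : ℕ → PBond (F.P K) 0 → ℝ} (hw : IsLevWeight F n K (cubeSeqMT3 F n K x₀ ρ S M hM) w) :
    ∃ W : (PBond (F.P K) 0 → Matrix (Fin 2) (Fin 2) ℂ) → (PBond (F.P K) 0 → Matrix (Fin 2) (Fin 2) ℂ),
      (∀ A δ : PBond (F.P K) 0 → Matrix (Fin 2) (Fin 2) ℂ, fderiv ℂ (fun A : PBond (F.P K) 0 → Matrix (Fin 2) (Fin 2) ℂ => (∑ p : Plaq (F.P K) 0, (1 - (2 : ℂ)⁻¹ * Matrix.trace (exp ((Complex.I * (((((F.L : ℝ)⁻¹) ^ (K - n) : ℝ)) : ℂ)) • A ⟨p.src, p.μ⟩) * exp ((Complex.I * (((((F.L : ℝ)⁻¹) ^ (K - n) : ℝ)) : ℂ)) • A ⟨p.src.shift p.μ, p.ν⟩) * exp (-((Complex.I * (((((F.L : ℝ)⁻¹) ^ (K - n) : ℝ)) : ℂ)) • A ⟨p.src.shift p.ν, p.μ⟩)) * exp (-((Complex.I * (((((F.L : ℝ)⁻¹) ^ (K - n) : ℝ)) : ℂ)) • A ⟨p.src, p.ν⟩))) + (2 : ℂ)⁻¹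 * Matrix.trace (((Complex.I * (((((F.L : ℝ)⁻¹) ^ (K - n) : ℝ)) : ℂ)) • A ⟨p.src, p.μ⟩) + ((Complex.I * (((((F.L : ℝ)⁻¹) ^ (K - n) : ℝ)) : ℂ)) • A ⟨p.src.shift p.μ, p.ν⟩) + (-((Complex.I * (((((F.L : ℝ)⁻¹) ^ (K - n) : ℝ)) : ℂ)) • A ⟨p.src.shift p.ν, p.μ⟩)) + (-((Complex.I * (((((F.L : ℝ)⁻¹) ^ (K - n) : ℝ)) : ℂ)) • A ⟨p.src, p.ν⟩))) + (4 : ℂ)⁻¹ * Matrix.trace ((((Complex.I * (((((F.L : ℝ)⁻¹) ^ (K - n) : ℝ)) : ℂ)) • A ⟨p.src, p.μ⟩) + ((Complex.I * (((((F.L : ℝ)⁻¹) ^ (K - n) : ℝ)) : ℂ)) • A ⟨p.src.shift p.μ, p.ν⟩) + (-((Complex.I * (((((F.L : ℝ)⁻¹) ^ (K - n) : ℝ)) : ℂ)) • A ⟨p.src.shift p.ν, p.μ⟩)) + (-((Complex.I * (((((F.L : ℝ)⁻¹) ^ (K - n) : ℝ)) : ℂ)) • A ⟨p.src, p.ν⟩)))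 ^ 2)))) A δ =
        ((((F.L : ℝ)⁻¹) ^ (K - n) : ℝ) : ℂ) ^ 4 * ∑ b : PBond (F.P K) 0, Matrix.trace (W A b * δ b)) ∧
      Differentiable ℂ W ∧
      (∀ (Y : PBond (F.P K) 0 → Matrix (Fin 2) (Fin 2) ℂ) (r : ℝ), r < 1 / 2 → (∀ b, ‖Y b‖ ≤ r) →
        (∀ (s : Site (F.P K) 0) (μ ν : Fin 3), (F.L : ℝ) ^ (K - n) * ‖Y ⟨s.shift ν, μ⟩ - Y ⟨s, μ⟩‖ ≤ r) → ∀ b, ‖W Y b‖ ≤ 18000 * r ^ 2) ∧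
      (∀ (Y : PBond (F.P K) 0 → Matrix (Fin 2) (Fin 2) ℂ) (r : ℝ), r < 1 / (2 * (F.L : ℝ)) → (∀ b, w 1 b * ‖Y b‖ ≤ r) →
        (∀ (b : PBond (F.P K) 0) (ν : Fin 3), w 2 b * (F.L : ℝ) ^ (K - n) * ‖Y ⟨b.src.shift ν, b.dir⟩ - Y b‖ ≤ r) →
          ∀ b, w 3 b * ‖W Y b‖ ≤ 12 * ((F.L : ℝ) ^ 3 * (1428 + (F.L : ℝ))) * r ^ 2) := by
  obtain ⟨W, _, hgrad, hWd, hWq⟩ := exists_gradient_prop4_bg1_T3 F n K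
  have hL1 : (1 : ℝ) ≤ F.L := by exact_mod_cast F.hL.2.le
  refine ⟨W, hgrad, hWd, hWq, ?_⟩
  exact weighted98_dom_T3 F n K (fun j => {x : Site (F.P K) 0 | (cubeSeqMT3 F n K x₀ ρ S M hM).InOm j x}) w hw hL1
    (fun b b' hd => levWeight_le_mul_of_dist_le_two F n K x₀ ρ S M hM hS hw b b' hd) W hgrad

end Summit.QuantumFields.YangMills.Theorems.FlatProp4Bg1

end
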